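import Summits.Ventures.HodgeRepro2.BallLines

/-!
# The group half of B2.5(b): `U(2,1)`, the Hodge map, eigenlines, negative lines

Sub-claim B2 (route/TIER4.md), step B2.5(b), identifies the conjugacy class `X` of the Hodge
map `h = (h₁, 1, 1)`, `h₁(z) = diag(1, 1, z/z̄)` (Liu p. 108 ll. 13–24), with the unit ball
`𝔹² ⊂ ℂ²` through the chain

  `g h₁ g⁻¹ ↦ the (z/z̄)-eigenline g·ℂe₃ ↦ a negative line of (W₁, H) ↦ its point of 𝔹²`.

`BallLines.lean` kernel-checked the last arrow (negative lines ↔ `𝔹²`).  This file checks the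
group-theoretic part, for the form `H(v, w) = v̄₁w₁ + v̄₂w₂ − v̄₃w₃` of Liu p. 107 l. 55 on
`W₁ ≅ ℂ³` and `U(2,1) = {g : gᴴ J g = J}`, `J = diag(1, 1, −1)`:

* `hodge z := diag(1, 1, z / z̄)` lies in `U(2,1)` for `z ≠ 0`, is multiplicative, and satisfies
  the CONJUGATE-DATUM identity `(hodge z).map conj = hodge (conj z)` of B2.6
  (`h_{V,τ̄₁} = h_{V,τ₁} ∘ (z ↦ z̄)`);
* for `z ∉ ℝ` the `(z/z̄)`-eigenspace of `g · hodge z · g⁻¹` is the line `g·ℂe₃`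
  (`eigenline_conj`), and `g·e₃` is a NEGATIVE vector, `H(ge₃, ge₃) = −1`
  (`hform_mulVec_single`), whose point of `𝔹²` is `BallLines.normalize (g e₃)`;
* the converse (every negative line is `g·ℂe₃` for some `g ∈ U(2,1)`: transitivity) and the
  well-definedness (`g·hodge z·g⁻¹` depends only on the line `g·ℂe₃`) are in the companion file
  `BallTransitive.lean`, which imports this one.
-/

namespace Summit.Ventures.HodgeRepro2.BallGroup

open Matrix

/-- The Gram matrix `J = diag(1, 1, −1)` of the form `diag(I₂, −I₁)` (Liu p. 107 l. 55). -/
def J : Matrix (Fin 3) (Fin 3) ℂ := Matrix.diagonal ![1, 1, -1]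

/-- The hermitian form `H(v, w) = vᴴ J w = v̄₁w₁ + v̄₂w₂ − v̄₃w₃` (conjugate-linear in `v`). -/
def hform (v w : Fin 3 → ℂ) : ℂ := star v ⬝ᵥ (J *ᵥ w)

/-- `U(2,1)`: the matrices preserving `H`, i.e. `gᴴ J g = J`. -/
def IsU21 (g : Matrix (Fin 3) (Fin 3) ℂ) : Prop := gᴴ * J * g = J

/-- The Hodge map at the place `ϑ₁`: `h₁(z) = diag(1, 1, z/z̄)` (Liu p. 108 ll. 13–24 with
`(p, q) = (2, 1)`). -/
noncomputable def hodge (z : ℂ) : Matrix (Fin 3) (Fin 3) ℂ := Matrix.diagonal ![1, 1, z / star z]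

/-- The third basis vector `e₃`, spanning the negative line `ℂe₃`. -/
def e₃ : Fin 3 → ℂ := Pi.single 2 1

/-- `J` acts on vectors by `(w₁, w₂, w₃) ↦ (w₁, w₂, −w₃)`. -/
theorem J_mulVec (w : Fin 3 → ℂ) : J *ᵥ w = ![w 0, w 1, -w 2] := by
  ext i
  fin_cases i <;> simp [J, Matrix.mulVec_diagonal]

/-- The explicit formula for `H`. -/
theorem hform_apply (v w : Fin 3 → ℂ) :
    hform v w = star (v 0) * w 0 + star (v 1) * w 1 - star (v 2) * w 2 := by
  simp [hform, J_mulVec, dotProduct, Fin.sum_univ_three, sub_eq_add_neg]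

/-- `H(v, v)` is real, with real part the quadratic form of `BallLines.lean`. -/
theorem hform_self_re (v : Fin 3 → ℂ) : (hform v v).re = BallLines.hermForm21 v := by
  rw [hform_apply, BallLines.hermForm21]
  simp only [Complex.star_def, Complex.conj_mul', Complex.sub_re, Complex.add_re]
  norm_cast

/-- Elements of `U(2,1)` preserve `H`. -/
theorem hform_mulVec {g : Matrix (Fin 3) (Fin 3) ℂ} (hg : IsU21 g) (v w : Fin 3 → ℂ) :
    hform (g *ᵥ v) (g *ᵥ w) = hform v w := by
  unfold hform
  rw [Matrix.star_mulVec, ← Matrix.dotProduct_mulVec, Matrix.mulVec_mulVec, Matrix.mulVec_mulVec,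
    hg]

/-- `e₃` is a negative vector: `H(e₃, e₃) = −1`. -/
theorem hform_single : hform e₃ e₃ = -1 := by
  simp [hform_apply, e₃]

/-- `g·e₃` is a negative vector for every `g ∈ U(2,1)`: `H(ge₃, ge₃) = −1`. -/
theorem hform_mulVec_single {g : Matrix (Fin 3) (Fin 3) ℂ} (hg : IsU21 g) :
    hform (g *ᵥ e₃) (g *ᵥ e₃) = -1 := by
  rw [hform_mulVec hg, hform_single]

/-- Hence `g·e₃` spans a negative line in the sense of `BallLines.lean`. -/
theorem hermForm21_mulVec_single_neg {g : Matrix (Fin 3) (Fin 3) ℂ} (hg : IsU21 g) :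
    BallLines.hermForm21 (g *ᵥ e₃) < 0 := by
  rw [← hform_self_re, hform_mulVec_single hg]
  norm_num

/-! ### The Hodge map: in `U(2,1)`, multiplicative, conjugate datum -/

/-- `h₁(z)ᴴ = h₁(z̄)`. -/
theorem hodge_conjTranspose (z : ℂ) : (hodge z)ᴴ = hodge (star z) := by
  ext i j
  fin_cases i <;> fin_cases j <;> simp [hodge, Matrix.conjTranspose_apply, star_div₀]

/-- `h₁(z) ∈ U(2,1)` for `z ≠ 0` (`|z/z̄| = 1`). -/
theorem isU21_hodge {z : ℂ} (hz : z ≠ 0) : IsU21 (hodge z) := by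
  unfold IsU21
  rw [hodge_conjTranspose]
  ext i j
  fin_cases i <;> fin_cases j <;> simp [hodge, J, Matrix.mul_diagonal]
  have hz' : (starRingEnd ℂ) z ≠ 0 := (map_ne_zero (starRingEnd ℂ)).2 hz
  field_simp

/-- `h₁` is a homomorphism `ℂ^× → U(2,1)`. -/
theorem hodge_mul {z w : ℂ} (hz : z ≠ 0) (hw : w ≠ 0) : hodge (z * w) = hodge z * hodge w := by
  ext i j
  fin_cases i <;> fin_cases j <;> simp [hodge]
  have hz' : star z ≠ 0 := star_ne_zero.2 hz
  have hw' : star w ≠ 0 := star_ne_zero.2 hw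
  field_simp

/-- **The conjugate datum (B2.6).** Entrywise complex conjugation of `h₁(z)` is `h₁(z̄)`:
`h_{V,τ̄₁} = h_{V,τ₁} ∘ (z ↦ z̄)`. -/
theorem hodge_map_star (z : ℂ) : (hodge z).map star = hodge (star z) := by
  ext i j
  fin_cases i <;> fin_cases j <;> simp [hodge]

/-! ### Invertibility and closure of `U(2,1)` -/

/-- `det J = −1`. -/
theorem det_J : J.det = -1 := by
  simp [J, Matrix.det_diagonal, Fin.prod_univ_three]

/-- Elements of `U(2,1)` are invertible. -/
theorem isUnit_det_of_isU21 {g : Matrix (Fin 3) (Fin 3) ℂ} (hg : IsU21 g) : IsUnit g.det := by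
  have h := congrArg Matrix.det hg
  rw [Matrix.det_mul, Matrix.det_mul, Matrix.det_conjTranspose, det_J] at h
  -- star (det g) * (-1) * det g = -1
  have h' : star g.det * g.det = 1 := by
    have := h
    linear_combination -this
  exact ⟨⟨g.det, star g.det, by rw [mul_comm]; exact h', h'⟩, rfl⟩

/-- `U(2,1)` is closed under multiplication. -/
theorem IsU21.mul {g k : Matrix (Fin 3) (Fin 3) ℂ} (hg : IsU21 g) (hk : IsU21 k) :
    IsU21 (g * k) := by
  unfold IsU21 at *
  calc (g * k)ᴴ * J * (g * k) = kᴴ * (gᴴ * J * g) * k := by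
        rw [Matrix.conjTranspose_mul]; simp only [Matrix.mul_assoc]
    _ = J := by rw [hg, hk]

/-- `U(2,1)` is closed under inversion. -/
theorem IsU21.inv {g : Matrix (Fin 3) (Fin 3) ℂ} (hg : IsU21 g) : IsU21 g⁻¹ := by
  have hdet := isUnit_det_of_isU21 hg
  have hdetH : IsUnit gᴴ.det := by
    rw [Matrix.det_conjTranspose]
    exact hdet.star
  unfold IsU21 at *
  rw [Matrix.conjTranspose_nonsing_inv]
  calc (gᴴ)⁻¹ * J * g⁻¹ = (gᴴ)⁻¹ * (gᴴ * J * g) * g⁻¹ := by rw [hg]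
    _ = (gᴴ)⁻¹ * gᴴ * J * (g * g⁻¹) := by simp only [Matrix.mul_assoc]
    _ = J := by
      rw [Matrix.nonsing_inv_mul _ hdetH, Matrix.mul_nonsing_inv _ hdet, Matrix.one_mul,
        Matrix.mul_one]

/-- The identity lies in `U(2,1)`. -/
theorem IsU21.one : IsU21 (1 : Matrix (Fin 3) (Fin 3) ℂ) := by
  simp [IsU21]

/-! ### Eigenlines: the `(z/z̄)`-eigenspace of `g·h₁(z)·g⁻¹` is the line `g·ℂe₃` -/

/-- For `z ≠ 0`: `z/z̄ ≠ 1` iff `z ∉ ℝ`. -/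
theorem div_star_ne_one_iff {z : ℂ} (hz : z ≠ 0) : z / star z ≠ 1 ↔ z.im ≠ 0 := by
  have hz' : star z ≠ 0 := star_ne_zero.2 hz
  rw [Ne, div_eq_one_iff_eq hz', Complex.star_def, eq_comm, Complex.conj_eq_iff_im]

/-- `h₁(z)` acts by `(v₁, v₂, v₃) ↦ (v₁, v₂, (z/z̄) v₃)`. -/
theorem hodge_mulVec (z : ℂ) (v : Fin 3 → ℂ) :
    hodge z *ᵥ v = ![v 0, v 1, z / star z * v 2] := by
  ext i
  fin_cases i <;> simp [hodge, Matrix.mulVec_diagonal]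

/-- For `z/z̄ ≠ 1`, the `(z/z̄)`-eigenvectors of `h₁(z)` are the vectors of the line `ℂe₃`. -/
theorem hodge_mulVec_eq_smul_iff {z : ℂ} (hz : z / star z ≠ 1) (v : Fin 3 → ℂ) :
    hodge z *ᵥ v = (z / star z) • v ↔ v 0 = 0 ∧ v 1 = 0 := by
  rw [hodge_mulVec]
  constructor
  · intro h
    have h0 := congrFun h 0
    have h1 := congrFun h 1
    simp only [Matrix.cons_val_zero, Pi.smul_apply, smul_eq_mul, Matrix.cons_val_one] at h0 h1
    have key : ∀ a : ℂ, a = z / star z * a → a = 0 := by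
      intro a ha
      have h2 : (1 - z / star z) * a = 0 := by linear_combination ha
      rcases mul_eq_zero.1 h2 with h3 | h3
      · exact absurd (sub_eq_zero.1 h3).symm hz
      · exact h3
    exact ⟨key _ h0, key _ h1⟩
  · rintro ⟨h0, h1⟩
    ext i
    fin_cases i <;> simp [h0, h1]

/-- `g⁻¹ (g w) = w` for invertible `g`. -/
theorem inv_mulVec_mulVec {g : Matrix (Fin 3) (Fin 3) ℂ} (hg : IsUnit g.det) (w : Fin 3 → ℂ) :
    g⁻¹ *ᵥ (g *ᵥ w) = w := by
  rw [Matrix.mulVec_mulVec, Matrix.nonsing_inv_mul _ hg, Matrix.one_mulVec]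

/-- `g (g⁻¹ w) = w` for invertible `g`. -/
theorem mulVec_inv_mulVec {g : Matrix (Fin 3) (Fin 3) ℂ} (hg : IsUnit g.det) (w : Fin 3 → ℂ) :
    g *ᵥ (g⁻¹ *ᵥ w) = w := by
  rw [Matrix.mulVec_mulVec, Matrix.mul_nonsing_inv _ hg, Matrix.one_mulVec]

/-- Eigenvectors of a conjugate `g A g⁻¹` are the `g`-images of eigenvectors of `A`. -/
theorem conj_mulVec_eq_smul_iff {g : Matrix (Fin 3) (Fin 3) ℂ} (hg : IsUnit g.det)
    (A : Matrix (Fin 3) (Fin 3) ℂ) (c : ℂ) (v : Fin 3 → ℂ) :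
    (g * A * g⁻¹) *ᵥ v = c • v ↔ A *ᵥ (g⁻¹ *ᵥ v) = c • (g⁻¹ *ᵥ v) := by
  constructor
  · intro h
    have h' : g⁻¹ *ᵥ ((g * A * g⁻¹) *ᵥ v) = g⁻¹ *ᵥ (c • v) := by rw [h]
    rwa [← Matrix.mulVec_mulVec, ← Matrix.mulVec_mulVec, inv_mulVec_mulVec hg,
      Matrix.mulVec_smul] at h'
  · intro h
    rw [← Matrix.mulVec_mulVec, ← Matrix.mulVec_mulVec, h, Matrix.mulVec_smul,
      mulVec_inv_mulVec hg]

/-- **The eigenline (B2.5(b)).** For `g ∈ U(2,1)` and `z/z̄ ≠ 1`, the `(z/z̄)`-eigenspace of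
`g·h₁(z)·g⁻¹` is exactly the line `g·ℂe₃` — so the conjugate `g h₁ g⁻¹` determines the
negative line `ℓ_g = g·ℂe₃`. -/
theorem eigenline_conj {g : Matrix (Fin 3) (Fin 3) ℂ} (hg : IsU21 g) {z : ℂ}
    (hz : z / star z ≠ 1) (v : Fin 3 → ℂ) :
    (g * hodge z * g⁻¹) *ᵥ v = (z / star z) • v ↔ ∃ c : ℂ, v = c • (g *ᵥ e₃) := by
  have hdet := isUnit_det_of_isU21 hg
  rw [conj_mulVec_eq_smul_iff hdet, hodge_mulVec_eq_smul_iff hz]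
  constructor
  · rintro ⟨h0, h1⟩
    refine ⟨(g⁻¹ *ᵥ v) 2, ?_⟩
    have hw : g⁻¹ *ᵥ v = (g⁻¹ *ᵥ v) 2 • e₃ := by
      ext i
      fin_cases i <;> simp [e₃, h0, h1]
    calc v = g *ᵥ (g⁻¹ *ᵥ v) := (mulVec_inv_mulVec hdet v).symm
      _ = g *ᵥ ((g⁻¹ *ᵥ v) 2 • e₃) := by rw [← hw]
      _ = (g⁻¹ *ᵥ v) 2 • (g *ᵥ e₃) := Matrix.mulVec_smul _ _ _
  · rintro ⟨c, rfl⟩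
    rw [Matrix.mulVec_smul, inv_mulVec_mulVec hdet]
    simp [e₃]

end Summit.Ventures.HodgeRepro2.BallGroup
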